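import Summits.CriticalPhenomena.PercolationContinuityZ3.Theses.PercNearOneGluing
import Literature.Probability.Percolation.PercolationEvents
import HarnessLib.Audit
import Summits.CriticalPhenomena.PercolationContinuityZ3.Theorems.PercNearOneGluingNearOneGluingVariants2415

/-! TTRL-lite variant V2450 of stmt-CriticalPhenomena-4574

(`stub_shorteningStep` of line `kn_shortening_induction`, move `specialise+small_case`:
`n := 5` and `A.card = 1`).  This variant is an instance of the already-landed sibling variant
V2415 (`A.card ≤ 2`, any `n`, `stub_shorteningStep_var2415`): with a single relay `A = {a₀}` the
claim is the Harris-type inequality `μ₁(v ↔ a₀) · μ₁(a₀ ↔ b) ≤ μ₁(v ↔ b)` for the glued measure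
`μ₁ = prodBernoulli (w[s(v,x) ↦ 1])`, which V2415 proves (for `|A| ≤ 2`) by transport to the
uncontracted measure, Harris, and Kozma–Nitzan Lemma 3 (arXiv:2401.12397); see the docstring of
V2415.  No new definitions, no named facts, the induction hypothesis is not used. -/

namespace Summit.CriticalPhenomena.PercolationContinuityZ3.Theorems

open MeasureTheory Set Literature.Probability.LatticeModels Literature.Probability.Percolation
open scoped Classical BigOperators

/-- TTRL-lite variant V2450 of `stub_shorteningStep` (stmt-CriticalPhenomena-4574, Kozma–Nitzan
Conjecture 6 with the induction hypothesis displayed): the shortening step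
`μ₁(⋃ a ∈ A, v ↔ a) · μ₁(a₀ ↔ b) ≤ μ₁(v ↔ b)` for the glued measure
`μ₁ = prodBernoulli (w[s(v,x) ↦ 1])` on `Fin 5`, in the one-relay case `A.card = 1`.
Immediate from the sibling variant `stub_shorteningStep_var2415` (case `A.card ≤ 2`, any `n`). -/
theorem stub_shorteningStep_var2450 : ∀ (w : Sym2 (Fin 5) → unitInterval) (A : Finset (Fin 5)) (b v x a₀ : Fin 5), A.card = 1 → v ∉ A → v ≠ x → w s(v, x) = 0 → a₀ ∈ A → (∀ a ∈ A, (prodBernoulli w).real (openConn a₀ b) ≤ (prodBernoulli w).real (openConn a b)) → (∀ w' : Sym2 (Fin 5) → unitInterval, (∀ e, w e = 0 → w' e = 0) → ∀ (A' : Finset (Fin 5)) (o' b' : Fin 5) (t : ℝ), (∀ a ∈ A', t ≤ (prodBernoulli w').real (openConn a b')) → (prodBernoulli w').real (⋃ a ∈ A', openConn o' a) * t ≤ (prodBernoulli w').real (openConn o' b')) → (prodBernoulli (Function.update w s(v, x) 1)).real (⋃ a ∈ A, openConn v a) * (prodBernoulli (Function.update w s(v, x) 1)).real (openConn a₀ b)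 ≤ (prodBernoulli (Function.update w s(v, x) 1)).real (openConn v b) := by
  intro w A b v x a₀ hcard
  exact stub_shorteningStep_var2415 5 w A b v x a₀ (by omega)

end Summit.CriticalPhenomena.PercolationContinuityZ3.Theorems
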